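import Summits.QuantumFields.YangMills.Theorems.BalabanUVNodesN15KingModelFullPropagatorGradRateProfile
import Summits.QuantumFields.YangMills.Theorems.BalabanUVNodesN15KingModelFullPropagatorRateProfileDecay

/-!
# BalabanUVNodes ∕ N15 — THE KING-MODEL RUNG, CURVED EDITION (PART S-f): THE GRADIENT TWINS OF PART S-e — the gradient two-spacing rate
# profile × unit-block decay (all pairs) and part O-b′'s off-diagonal gradient η-rate with its threshold `D₀` REPLACED BY `2`
# (Track A, DAG node N15 = NE2; FAN-OUT v1.1 §N15 s3 «KING-MODEL RUNG … + the one-line statement of what the curved case adds»)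

HONEST FRAMING.  Count-neutral kernel bookkeeping (cell `pub-ymgap`, seat `pub-ymgap-dag-n15-e` g8; `--supports stmt-QuantumFields-20296
--as helper` = K3⁵ `SpineGivenEndpointR13SepCoP`, WORDS-141).  TEMPLATE LITERATURE, `A = 0`: C. King's scalar U(1)-Higgs MODEL on finite tori ([King1986]
§2.2 p. 653 (2.13)–(2.17), p. 654 (2.20), Prop. 3.8 (3.71) p. 664 second line, Prop. 3.9 (3.73) p. 665 second line), NOT Bałaban's covariant
objects; the statements below are (2.17)-SUMMED SHAPES for King's (2.13) at `A = 0`, NOT printed propositions; NE2⁺ is NOT PRINTED and not proved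
here; NOT a node discharge; nothing continuum ∕ ℝ⁴ ∕ OS ∕ mass-gap ∕ Clay.  0 `sorry`, 0 `def`, standard axioms.

THE POINT.  Part S-e did, for the KERNEL pair, «rate profile × block decay» and «part O-b with `D₀ → 2`»; THIS FILE is its twin for the GRADIENT
pair `∂G′ = L^nL^K[G′(x′+e_μ, y′) − G′(x′, y′)]`, `∂G = L^K[G(x+e_μ, y) − G(x, y)]` (part S-c's profile `fullPropD_rateProfile_unif`):
* §1 ★ **`fullPropD_rateProfile_decay_unif`** (`0 ≤ γ < 1`): ALL pairs, part S-c's profile TIMES `e^{−δ·|B(x) − B(y)|_M}`;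
* §2 ★★ **`fullPropD_rate_two_blocks_unif`** (`0 ≤ γ < 1`, every `d`): `2 ≤ |B(x) − B(y)|_M → |∂G′(x′, y′) − ∂G(x, y)| ≤ C·θ^K·e^{−δ|B(x)−B(y)|_M}` —
  part O-b′'s display with its threshold `D₀` REPLACED BY `2`.
WHAT THE CURVED CASE ADDS (one line): the same for Bałaban's `∇_UG_k(U)` pair uniformly over `Reg335` (not printed as an η-difference).
HONEST SCOPE.  (i) `A = 0`, periodic b.c., odd `L ≥ 3`, `0 < m² ≤ m₀²`, cubes `2L^e`; (ii) lattice units of the respective levels; (iii) `K, n ≥ 1`;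
(iv) decay rate half of part S-c's; (v) not Bałaban's `∇G_k(U)`; not a discharge.
Locators: [King1986] C. King, CMP **102** (1986) 649–677: (2.13)–(2.17) p. 653, (2.20) p. 654, Prop. 3.7 (3.63) p. 663, Prop. 3.8 (3.71) p. 664,
Prop. 3.9 (3.73) p. 665, (4.42)–(4.43) p. 675; [B9] = [Balaban1985BackgroundPropagators] Thm 3.14 pp. 426–427 (template).
-/

noncomputable section

namespace Summit.QuantumFields.YangMills.BalabanUVNodes.N15KingModelRung.Curved

open Real Finset Matrix
open Literature.MathematicalPhysics.QuantumFieldTheory.Balaban1983to89.B5Prop11Plancherel (Tor fine unitVec)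
open Literature.MathematicalPhysics.QuantumFieldTheory.King1986 (aK aK_pos pow_mul_exp_neg_le)
open Literature.MathematicalPhysics.QuantumFieldTheory.King1986.Torus (constrainedProp blockOf tdistT tdistT_nonneg)

variable {d : ℕ} (L : ℕ) [NeZero L]

/-! ## §1 The gradient rate profile with the unit-block decay, all pairs -/

/-- **THE GRADIENT TWO-SPACING RATE PROFILE WITH THE UNIT-BLOCK DECAY, ALL PAIRS** (`0 ≤ γ < 1`): for odd `L ≥ 3`, `a > 0`, `m₀² ≥ 0` there are
`C, δ > 0` such that for EVERY `K ≥ 1`, `n ≥ 1`, cube `M_μ = 2L^e`, mass `0 < m² ≤ m₀²` and ALL fine points `x′, y′` of the `(K+n)`-level run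
(`x = underPtN x′`, `r′` the fine distance, `N′ = L^nL^K`, `θ = L^{−γ∕2}`):
`|∂G′(x′, y′) − ∂G(x, y)| ≤ C·[θ^K·Σ_{i<K}(ΛL·L^{γ∕2})^i e^{−δr′L^i∕N′} + Σ_{i<n}(ΛL)^{K+i} e^{−δr′L^{K+i}∕N′}]·e^{−δ·|B(x) − B(y)|_M}` — part S-c's
profile times the unit-block decay of part O-b′, no threshold. [cite: King1986, (2.13)–(2.17) p.653, Prop. 3.8 (3.71) p.664, Prop. 3.9 (3.73) p.665, (4.42)–(4.43) p.675] -/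
theorem fullPropD_rateProfile_decay_unif (hLodd : Odd L) (hL : 2 ≤ L) {a : ℝ} (ha : 0 < a) {m0sq : ℝ} (hm0 : 0 ≤ m0sq) {γ : ℝ}
    (hγ0 : 0 ≤ γ) (hγ1 : γ < 1) :
    ∃ C δ : ℝ, 0 < C ∧ 0 < δ ∧ ∀ (K : ℕ), 1 ≤ K → ∀ (n : ℕ), 1 ≤ n →
      ∀ (e : ℕ) (M : Fin (d + 1) → ℕ) [∀ μ, NeZero (M μ)], (∀ μ, M μ = 2 * L ^ e) →
      ∀ (msq : ℝ), 0 < msq → msq ≤ m0sq →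
      ∀ (μ : Fin (d + 1)) (x' y' : Tor (fine (L ^ n * L ^ K) M)),
        |((L ^ n * L ^ K : ℕ) : ℝ) *
              (constrainedProp (L ^ n * L ^ K) M (aK a L (K + n)) (((L ^ n * L ^ K : ℕ) : ℝ) ^ 2) msq
                  (x' + unitVec (fine (L ^ n * L ^ K) M) μ) y'
                - constrainedProp (L ^ n * L ^ K) M (aK a L (K + n)) (((L ^ n * L ^ K : ℕ) : ℝ) ^ 2) msq x' y')
            - ((L ^ K : ℕ) : ℝ) *
              (constrainedProp (L ^ K) M (aK a L K) (((L ^ K : ℕ) : ℝ) ^ 2) msq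
                  (underPtN L K n M x' + unitVec (fine (L ^ K) M) μ) (underPtN L K n M y')
                - constrainedProp (L ^ K) M (aK a L K) (((L ^ K : ℕ) : ℝ) ^ 2) msq
                  (underPtN L K n M x') (underPtN L K n M y'))|
          ≤ C * ((((L : ℝ) ^ (-(γ / 2))) ^ K)
                  * ∑ i ∈ Finset.range K, ((L : ℝ) ^ (d + 1) / (L : ℝ) ^ 2 * L * (L : ℝ) ^ (γ / 2)) ^ i
                      * Real.exp (-(δ * (tdistT (fine (L ^ n * L ^ K) M) x' y' * (L : ℝ) ^ i / ((L ^ n * L ^ K : ℕ) : ℝ))))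
                + ∑ i ∈ Finset.range n, ((L : ℝ) ^ (d + 1) / (L : ℝ) ^ 2 * L) ^ (K + i)
                      * Real.exp (-(δ * (tdistT (fine (L ^ n * L ^ K) M) x' y' * (L : ℝ) ^ (K + i)
                          / ((L ^ n * L ^ K : ℕ) : ℝ)))))
            * Real.exp (-(δ * tdistT M (blockOf (L ^ K) M (underPtN L K n M x')) (blockOf (L ^ K) M (underPtN L K n M y')))) := by
  have hLr : (1 : ℝ) ≤ L := by exact_mod_cast (show 1 ≤ L by omega)
  have hL0 : (0 : ℝ) < L := by linarith
  obtain ⟨C₀, δ₀, hC₀, hδ₀, H⟩ := fullPropD_rateProfile_unif (d := d) L hLodd hL ha hm0 hγ0 hγ1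
  refine ⟨C₀ * Real.exp (δ₀ / 2), δ₀ / 2, by positivity, by positivity, ?_⟩
  intro K hK n hn e M _ hM msq hmsq hcap μ x' y'
  have h := H K hK n hn e M hM msq hmsq hcap μ x' y'
  set θK : ℝ := ((L : ℝ) ^ (-(γ / 2))) ^ K with hθKdef
  have hθK : 0 ≤ θK := pow_nonneg (Real.rpow_nonneg hL0.le _) K
  set Λ : ℝ := (L : ℝ) ^ (d + 1) / (L : ℝ) ^ 2 * L with hΛdef
  set Λ' : ℝ := Λ * (L : ℝ) ^ (γ / 2) with hΛ'def
  have hΛ : 0 ≤ Λ := by positivity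
  have hΛ' : 0 ≤ Λ' := mul_nonneg hΛ (Real.rpow_nonneg hL0.le _)
  set r' : ℝ := tdistT (fine (L ^ n * L ^ K) M) x' y' with hr'def
  set N' : ℝ := ((L ^ n * L ^ K : ℕ) : ℝ) with hN'def
  set D : ℝ := tdistT M (blockOf (L ^ K) M (underPtN L K n M x')) (blockOf (L ^ K) M (underPtN L K n M y')) with hDdef
  have hN1 : (1 : ℝ) ≤ N' := by
    rw [hN'def]
    exact_mod_cast Nat.one_le_iff_ne_zero.mpr (Nat.mul_ne_zero (pow_ne_zero _ (by omega)) (pow_ne_zero _ (by omega)))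
  have hr0 : 0 ≤ r' := tdistT_nonneg _ x' y'
  -- `B(x) = B(x′)`: the block decay condition `N′·D ≤ r′ + (N′ − 1)`
  have hD : N' * D ≤ r' + (N' - 1) := by
    rw [hDdef, blockOf_underPtN, blockOf_underPtN]
    exact mul_tdistT_blockOf_le (L ^ n * L ^ K) M x' y'
  -- every level decays at least on the unit scale
  have hsplit : ∀ (m : ℕ), Real.exp (-(δ₀ * (r' * (L : ℝ) ^ m / N')))
      ≤ Real.exp (δ₀ / 2) * Real.exp (-(δ₀ / 2 * D)) * Real.exp (-(δ₀ / 2 * (r' * (L : ℝ) ^ m / N'))) := fun m =>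
    exp_level_split hδ₀.le hr0 (one_le_pow₀ hLr) hN1 hD
  set E : ℝ := Real.exp (δ₀ / 2) * Real.exp (-(δ₀ / 2 * D)) with hEdef
  have hE0 : 0 ≤ E := by positivity
  have hS : ∑ i ∈ Finset.range K, Λ' ^ i * Real.exp (-(δ₀ * (r' * (L : ℝ) ^ i / N')))
      ≤ E * ∑ i ∈ Finset.range K, Λ' ^ i * Real.exp (-(δ₀ / 2 * (r' * (L : ℝ) ^ i / N'))) := by
    rw [Finset.mul_sum]
    exact Finset.sum_le_sum fun i _ => by
      calc Λ' ^ i * Real.exp (-(δ₀ * (r' * (L : ℝ) ^ i / N')))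
          ≤ Λ' ^ i * (E * Real.exp (-(δ₀ / 2 * (r' * (L : ℝ) ^ i / N')))) :=
            mul_le_mul_of_nonneg_left (hsplit i) (pow_nonneg hΛ' i)
        _ = E * (Λ' ^ i * Real.exp (-(δ₀ / 2 * (r' * (L : ℝ) ^ i / N')))) := by ring
  have hP : θK * ∑ i ∈ Finset.range K, Λ' ^ i * Real.exp (-(δ₀ * (r' * (L : ℝ) ^ i / N')))
      ≤ E * (θK * ∑ i ∈ Finset.range K, Λ' ^ i * Real.exp (-(δ₀ / 2 * (r' * (L : ℝ) ^ i / N')))) := by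
    calc θK * ∑ i ∈ Finset.range K, Λ' ^ i * Real.exp (-(δ₀ * (r' * (L : ℝ) ^ i / N')))
        ≤ θK * (E * ∑ i ∈ Finset.range K, Λ' ^ i * Real.exp (-(δ₀ / 2 * (r' * (L : ℝ) ^ i / N')))) :=
          mul_le_mul_of_nonneg_left hS hθK
      _ = E * (θK * ∑ i ∈ Finset.range K, Λ' ^ i * Real.exp (-(δ₀ / 2 * (r' * (L : ℝ) ^ i / N')))) := by ring
  have hU : ∑ i ∈ Finset.range n, Λ ^ (K + i) * Real.exp (-(δ₀ * (r' * (L : ℝ) ^ (K + i) / N')))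
      ≤ E * ∑ i ∈ Finset.range n, Λ ^ (K + i) * Real.exp (-(δ₀ / 2 * (r' * (L : ℝ) ^ (K + i) / N'))) := by
    rw [Finset.mul_sum]
    exact Finset.sum_le_sum fun i _ => by
      calc Λ ^ (K + i) * Real.exp (-(δ₀ * (r' * (L : ℝ) ^ (K + i) / N')))
          ≤ Λ ^ (K + i) * (E * Real.exp (-(δ₀ / 2 * (r' * (L : ℝ) ^ (K + i) / N')))) :=
            mul_le_mul_of_nonneg_left (hsplit (K + i)) (pow_nonneg hΛ _)
        _ = E * (Λ ^ (K + i) * Real.exp (-(δ₀ / 2 * (r' * (L : ℝ) ^ (K + i) / N')))) := by ring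
  calc |((L ^ n * L ^ K : ℕ) : ℝ) *
              (constrainedProp (L ^ n * L ^ K) M (aK a L (K + n)) (((L ^ n * L ^ K : ℕ) : ℝ) ^ 2) msq
                  (x' + unitVec (fine (L ^ n * L ^ K) M) μ) y'
                - constrainedProp (L ^ n * L ^ K) M (aK a L (K + n)) (((L ^ n * L ^ K : ℕ) : ℝ) ^ 2) msq x' y')
            - ((L ^ K : ℕ) : ℝ) *
              (constrainedProp (L ^ K) M (aK a L K) (((L ^ K : ℕ) : ℝ) ^ 2) msq
                  (underPtN L K n M x' + unitVec (fine (L ^ K) M) μ) (underPtN L K n M y')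
                - constrainedProp (L ^ K) M (aK a L K) (((L ^ K : ℕ) : ℝ) ^ 2) msq
                  (underPtN L K n M x') (underPtN L K n M y'))|
      ≤ C₀ * (θK * ∑ i ∈ Finset.range K, Λ' ^ i * Real.exp (-(δ₀ * (r' * (L : ℝ) ^ i / N')))
          + ∑ i ∈ Finset.range n, Λ ^ (K + i) * Real.exp (-(δ₀ * (r' * (L : ℝ) ^ (K + i) / N')))) := h
    _ ≤ C₀ * (E * (θK * ∑ i ∈ Finset.range K, Λ' ^ i * Real.exp (-(δ₀ / 2 * (r' * (L : ℝ) ^ i / N'))))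
          + E * ∑ i ∈ Finset.range n, Λ ^ (K + i) * Real.exp (-(δ₀ / 2 * (r' * (L : ℝ) ^ (K + i) / N')))) :=
        mul_le_mul_of_nonneg_left (add_le_add hP hU) hC₀.le
    _ = C₀ * Real.exp (δ₀ / 2)
          * (θK * ∑ i ∈ Finset.range K, Λ' ^ i * Real.exp (-(δ₀ / 2 * (r' * (L : ℝ) ^ i / N')))
            + ∑ i ∈ Finset.range n, Λ ^ (K + i) * Real.exp (-(δ₀ / 2 * (r' * (L : ℝ) ^ (K + i) / N'))))
          * Real.exp (-(δ₀ / 2 * D)) := by rw [hEdef]; ring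

/-! ## §2 Part O-b′'s off-diagonal gradient two-spacing rate with the threshold `2` -/

/-- **THE OFF-DIAGONAL GRADIENT TWO-SPACING η-RATE WITH THRESHOLD `2`** (`0 ≤ γ < 1`): `∃ C, δ > 0 ∀ K ≥ 1 ∀ n ≥ 1 ∀ cube 2L^e ∀ 0 < m² ≤ m₀² ∀ μ x′ y′,
2 ≤ |B(x) − B(y)|_M → |∂G′(x′, y′) − ∂G(x, y)| ≤ C·(L^{−γ∕2})^K·e^{−δ·|B(x) − B(y)|_M}` — part O-b′'s `fullPropD_rate_unif` with its threshold `D₀`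
REPLACED BY `2` (paired levels `≤ (d+2)!δ^{−(d+2)}·L^{−i}`, unpaired `≤ (d+2)!δ^{−(d+2)}·L^{−2K}L^{−i}`, `L^{−2K} ≤ θ^K`).
[cite: King1986, (2.13)–(2.17) p.653, Prop. 3.8 (3.71) p.664, Prop. 3.9 (3.73) p.665, (4.42)–(4.43) p.675] -/
theorem fullPropD_rate_two_blocks_unif (hLodd : Odd L) (hL : 2 ≤ L) {a : ℝ} (ha : 0 < a) {m0sq : ℝ} (hm0 : 0 ≤ m0sq) {γ : ℝ}
    (hγ0 : 0 ≤ γ) (hγ1 : γ < 1) :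
    ∃ C δ : ℝ, 0 < C ∧ 0 < δ ∧ ∀ (K : ℕ), 1 ≤ K → ∀ (n : ℕ), 1 ≤ n →
      ∀ (e : ℕ) (M : Fin (d + 1) → ℕ) [∀ μ, NeZero (M μ)], (∀ μ, M μ = 2 * L ^ e) →
      ∀ (msq : ℝ), 0 < msq → msq ≤ m0sq →
      ∀ (μ : Fin (d + 1)) (x' y' : Tor (fine (L ^ n * L ^ K) M)),
        2 ≤ tdistT M (blockOf (L ^ K) M (underPtN L K n M x')) (blockOf (L ^ K) M (underPtN L K n M y')) →
        |((L ^ n * L ^ K : ℕ) : ℝ) *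
              (constrainedProp (L ^ n * L ^ K) M (aK a L (K + n)) (((L ^ n * L ^ K : ℕ) : ℝ) ^ 2) msq
                  (x' + unitVec (fine (L ^ n * L ^ K) M) μ) y'
                - constrainedProp (L ^ n * L ^ K) M (aK a L (K + n)) (((L ^ n * L ^ K : ℕ) : ℝ) ^ 2) msq x' y')
            - ((L ^ K : ℕ) : ℝ) *
              (constrainedProp (L ^ K) M (aK a L K) (((L ^ K : ℕ) : ℝ) ^ 2) msq
                  (underPtN L K n M x' + unitVec (fine (L ^ K) M) μ) (underPtN L K n M y')
                - constrainedProp (L ^ K) M (aK a L K) (((L ^ K : ℕ) : ℝ) ^ 2) msq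
                  (underPtN L K n M x') (underPtN L K n M y'))|
          ≤ C * (((L : ℝ) ^ (-(γ / 2))) ^ K)
              * Real.exp (-(δ * tdistT M (blockOf (L ^ K) M (underPtN L K n M x'))
                  (blockOf (L ^ K) M (underPtN L K n M y')))) := by
  have hLr2 : (2 : ℝ) ≤ L := by exact_mod_cast hL
  have hLr : (1 : ℝ) ≤ L := by linarith
  have hL0 : (0 : ℝ) < L := by linarith
  obtain ⟨C₀, δ, hC₀, hδ, H⟩ := fullPropD_rateProfile_decay_unif (d := d) L hLodd hL ha hm0 hγ0 hγ1
  -- the per-level constant `(d+1)!∕δ^{d+1}`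
  set A : ℝ := (d + 2).factorial / δ ^ (d + 2) with hAdef
  have hA0 : 0 < A := by positivity
  refine ⟨C₀ * (4 * A), δ, by positivity, hδ, ?_⟩
  intro K hK n hn e M _ hM msq hmsq hcap μ x' y' hD2
  have h := H K hK n hn e M hM msq hmsq hcap μ x' y'
  set θ : ℝ := (L : ℝ) ^ (-(γ / 2)) with hθdef
  have hθ0 : 0 < θ := Real.rpow_pos_of_pos hL0 _
  set Λ : ℝ := (L : ℝ) ^ (d + 1) / (L : ℝ) ^ 2 * L with hΛdef
  set φ : ℝ := (L : ℝ) ^ (γ / 2) with hφdef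
  have hΛ : 0 < Λ := by positivity
  have hφ0 : 0 < φ := Real.rpow_pos_of_pos hL0 _
  have hφL : φ ≤ L := by
    calc φ ≤ (L : ℝ) ^ (1 : ℝ) := Real.rpow_le_rpow_of_exponent_le hLr (by linarith)
      _ = L := Real.rpow_one _
  set r' : ℝ := tdistT (fine (L ^ n * L ^ K) M) x' y' with hr'def
  set N' : ℝ := ((L ^ n * L ^ K : ℕ) : ℝ) with hN'def
  set D : ℝ := tdistT M (blockOf (L ^ K) M (underPtN L K n M x')) (blockOf (L ^ K) M (underPtN L K n M y')) with hDdef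
  have hN0 : (0 : ℝ) < N' := by
    rw [hN'def]
    exact_mod_cast Nat.pos_of_ne_zero (Nat.mul_ne_zero (pow_ne_zero _ (by omega)) (pow_ne_zero _ (by omega)))
  have hDb : N' * D ≤ r' + (N' - 1) := by
    rw [hDdef, blockOf_underPtN, blockOf_underPtN]
    exact mul_tdistT_blockOf_le (L ^ n * L ^ K) M x' y'
  -- unit blocks `≥ 2` apart ⇒ `r′ ≥ N′`
  have hres : N' ≤ r' := by nlinarith
  have hq : ∀ m : ℕ, (L : ℝ) ^ m ≤ r' * (L : ℝ) ^ m / N' := fun m => by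
    rw [le_div_iff₀ hN0]
    nlinarith [pow_pos hL0 m]
  -- one level of scale exponent `m`: `Λ^m·L^m·e^{−δ·(r′L^m∕N′)} ≤ A·L^{−m}` (via `e^{−x} ≤ (d+1)!∕x^{d+1}` at `x = δL^m`)
  have hlevel : ∀ m : ℕ, Λ ^ m * (L : ℝ) ^ m * Real.exp (-(δ * (r' * (L : ℝ) ^ m / N'))) ≤ A * ((L : ℝ)⁻¹) ^ m := fun m => by
    have ht : 0 < (L : ℝ) ^ m := pow_pos hL0 m
    have he1 : Real.exp (-(δ * (r' * (L : ℝ) ^ m / N'))) ≤ Real.exp (-(δ * (L : ℝ) ^ m)) :=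
      Real.exp_le_exp.mpr (neg_le_neg (mul_le_mul_of_nonneg_left (hq m) hδ.le))
    -- `t^d·e^{−δt} ≤ (d+1)!∕(δ^{d+1}t)` at `t = L^m` (`King1986.pow_mul_exp_neg_le`)
    have he2 := pow_mul_exp_neg_le hδ ht (d + 1)
    have hid1 : Λ ^ m * (L : ℝ) ^ m = ((L : ℝ) ^ m) ^ (d + 1) := by
      rw [hΛdef, LamL_eq_pow L hL]
      ring
    have hid2 : ((d + 1 + 1).factorial : ℝ) / (δ ^ (d + 1 + 1) * (L : ℝ) ^ m) = A * ((L : ℝ)⁻¹) ^ m := by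
      rw [hAdef, inv_pow, show d + 1 + 1 = d + 2 by omega]
      field_simp
    calc Λ ^ m * (L : ℝ) ^ m * Real.exp (-(δ * (r' * (L : ℝ) ^ m / N')))
        ≤ Λ ^ m * (L : ℝ) ^ m * Real.exp (-(δ * (L : ℝ) ^ m)) := mul_le_mul_of_nonneg_left he1 (by positivity)
      _ = ((L : ℝ) ^ m) ^ (d + 1) * Real.exp (-(δ * (L : ℝ) ^ m)) := by rw [hid1]
      _ ≤ ((d + 1 + 1).factorial : ℝ) / (δ ^ (d + 1 + 1) * (L : ℝ) ^ m) := he2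
      _ = A * ((L : ℝ)⁻¹) ^ m := hid2
  -- paired levels: `(Λφ)^i ≤ Λ^i L^i`
  have hpaired : ∑ i ∈ Finset.range K, (Λ * φ) ^ i * Real.exp (-(δ * (r' * (L : ℝ) ^ i / N'))) ≤ A * 2 := by
    calc ∑ i ∈ Finset.range K, (Λ * φ) ^ i * Real.exp (-(δ * (r' * (L : ℝ) ^ i / N')))
        ≤ ∑ i ∈ Finset.range K, A * ((L : ℝ)⁻¹) ^ i := Finset.sum_le_sum fun i _ => by
          calc (Λ * φ) ^ i * Real.exp (-(δ * (r' * (L : ℝ) ^ i / N')))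
              ≤ Λ ^ i * (L : ℝ) ^ i * Real.exp (-(δ * (r' * (L : ℝ) ^ i / N'))) := by
                rw [mul_pow]
                exact mul_le_mul_of_nonneg_right (mul_le_mul_of_nonneg_left (pow_le_pow_left₀ hφ0.le hφL i) (pow_nonneg hΛ.le i))
                  (Real.exp_pos _).le
            _ ≤ A * ((L : ℝ)⁻¹) ^ i := hlevel i
      _ = A * ∑ i ∈ Finset.range K, ((L : ℝ)⁻¹) ^ i := (Finset.mul_sum _ _ _).symm
      _ ≤ A * 2 := mul_le_mul_of_nonneg_left (sum_inv_pow_le_two hLr2 K) hA0.le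
  -- unpaired levels: `Λ^{K+i} e^{−δ L^{K+i}} ≤ A·L^{−2(K+i)} ≤ A·L^{−2K}·L^{−i}`, and `L^{−2K} ≤ θ^K`
  have hL2θ : ((L : ℝ)⁻¹) ^ (2 * K) ≤ θ ^ K := by
    rw [pow_mul]
    apply pow_le_pow_left₀ (by positivity)
    rw [hθdef, ← Real.rpow_neg_one, ← Real.rpow_natCast, ← Real.rpow_mul hL0.le]
    exact Real.rpow_le_rpow_of_exponent_le hLr (by norm_num; linarith)
  have hunpaired : ∑ i ∈ Finset.range n, Λ ^ (K + i) * Real.exp (-(δ * (r' * (L : ℝ) ^ (K + i) / N'))) ≤ A * 2 * θ ^ K := by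
    have hterm : ∀ i ∈ Finset.range n, Λ ^ (K + i) * Real.exp (-(δ * (r' * (L : ℝ) ^ (K + i) / N')))
        ≤ A * ((L : ℝ)⁻¹) ^ (2 * K) * ((L : ℝ)⁻¹) ^ i := fun i _ => by
      have h1 := hlevel (K + i)
      have hLi : (1 : ℝ) ≤ (L : ℝ) ^ (K + i) := one_le_pow₀ hLr
      -- `Λ^{K+i} ≤ Λ^{K+i}·L^{K+i}·L^{−(K+i)}` and `L^{−(K+i)}·L^{−(K+i)} ≤ L^{−2K}·L^{−i}`
      have hid : A * ((L : ℝ)⁻¹) ^ (K + i) * ((L : ℝ)⁻¹) ^ (K + i) = A * ((L : ℝ)⁻¹) ^ (2 * K) * (((L : ℝ)⁻¹) ^ i * ((L : ℝ)⁻¹) ^ i) := by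
        rw [two_mul, pow_add, pow_add]; ring
      have hii : ((L : ℝ)⁻¹) ^ i * ((L : ℝ)⁻¹) ^ i ≤ ((L : ℝ)⁻¹) ^ i := by
        have h0 : 0 ≤ ((L : ℝ)⁻¹) ^ i := by positivity
        have h1' : ((L : ℝ)⁻¹) ^ i ≤ 1 := pow_le_one₀ (by positivity) (inv_le_one_of_one_le₀ hLr)
        nlinarith
      calc Λ ^ (K + i) * Real.exp (-(δ * (r' * (L : ℝ) ^ (K + i) / N')))
          = Λ ^ (K + i) * (L : ℝ) ^ (K + i) * Real.exp (-(δ * (r' * (L : ℝ) ^ (K + i) / N'))) * ((L : ℝ)⁻¹) ^ (K + i) := by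
            rw [inv_pow]; field_simp
        _ ≤ A * ((L : ℝ)⁻¹) ^ (K + i) * ((L : ℝ)⁻¹) ^ (K + i) := mul_le_mul_of_nonneg_right h1 (by positivity)
        _ = A * ((L : ℝ)⁻¹) ^ (2 * K) * (((L : ℝ)⁻¹) ^ i * ((L : ℝ)⁻¹) ^ i) := hid
        _ ≤ A * ((L : ℝ)⁻¹) ^ (2 * K) * ((L : ℝ)⁻¹) ^ i := mul_le_mul_of_nonneg_left hii (by positivity)
    calc ∑ i ∈ Finset.range n, Λ ^ (K + i) * Real.exp (-(δ * (r' * (L : ℝ) ^ (K + i) / N')))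
        ≤ ∑ i ∈ Finset.range n, A * ((L : ℝ)⁻¹) ^ (2 * K) * ((L : ℝ)⁻¹) ^ i := Finset.sum_le_sum hterm
      _ = A * ((L : ℝ)⁻¹) ^ (2 * K) * ∑ i ∈ Finset.range n, ((L : ℝ)⁻¹) ^ i := (Finset.mul_sum _ _ _).symm
      _ ≤ A * ((L : ℝ)⁻¹) ^ (2 * K) * 2 := mul_le_mul_of_nonneg_left (sum_inv_pow_le_two hLr2 n) (by positivity)
      _ ≤ A * θ ^ K * 2 := by
          have := mul_le_mul_of_nonneg_left hL2θ hA0.le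
          nlinarith
      _ = A * 2 * θ ^ K := by ring
  have hE : 0 ≤ Real.exp (-(δ * D)) := (Real.exp_pos _).le
  have hθK : 0 ≤ θ ^ K := pow_nonneg hθ0.le K
  calc |((L ^ n * L ^ K : ℕ) : ℝ) *
              (constrainedProp (L ^ n * L ^ K) M (aK a L (K + n)) (((L ^ n * L ^ K : ℕ) : ℝ) ^ 2) msq
                  (x' + unitVec (fine (L ^ n * L ^ K) M) μ) y'
                - constrainedProp (L ^ n * L ^ K) M (aK a L (K + n)) (((L ^ n * L ^ K : ℕ) : ℝ) ^ 2) msq x' y')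
            - ((L ^ K : ℕ) : ℝ) *
              (constrainedProp (L ^ K) M (aK a L K) (((L ^ K : ℕ) : ℝ) ^ 2) msq
                  (underPtN L K n M x' + unitVec (fine (L ^ K) M) μ) (underPtN L K n M y')
                - constrainedProp (L ^ K) M (aK a L K) (((L ^ K : ℕ) : ℝ) ^ 2) msq
                  (underPtN L K n M x') (underPtN L K n M y'))|
      ≤ C₀ * (θ ^ K * ∑ i ∈ Finset.range K, (Λ * φ) ^ i * Real.exp (-(δ * (r' * (L : ℝ) ^ i / N')))
          + ∑ i ∈ Finset.range n, Λ ^ (K + i) * Real.exp (-(δ * (r' * (L : ℝ) ^ (K + i) / N')))) * Real.exp (-(δ * D)) := h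
    _ ≤ C₀ * (θ ^ K * (A * 2) + A * 2 * θ ^ K) * Real.exp (-(δ * D)) :=
        mul_le_mul_of_nonneg_right (mul_le_mul_of_nonneg_left
          (add_le_add (mul_le_mul_of_nonneg_left hpaired hθK) hunpaired) hC₀.le) hE
    _ = C₀ * (4 * A) * θ ^ K * Real.exp (-(δ * D)) := by ring

end Summit.QuantumFields.YangMills.BalabanUVNodes.N15KingModelRung.Curved
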